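import Summits.HodgeConjecture.HodgeConjecture.Theses.KugaSatakeSaturation
import Literature.AlgebraicGeometry.Motives.HodgeTensorFactsHolds

/-!
# Crux `Saturation` (stmt-HodgeConjecture-9371) — line `twist-split` (crux-strategist; registered skeleton)

The typed decomposition `Saturation ⇐ TwistGeneration ∧ TwistAbsorption` (route items
stmt-HodgeConjecture-17602 / 17603, glue item 17611 `SaturationOfTwists`) written as ONE checked
skeleton concluding the route decl `Saturation` BY NAME, with each piece cut at its own joints:

* `TwistAbsorption` (every `E`-twisted Kuga–Satake embedding `t ↦ L_{ι(e t)}` lies in the bimodule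
  span `N`) ⇐ Zarhin's dichotomy: `stub_absorption_real` (all Hodge endomorphisms `P`-self-adjoint,
  `E` totally real: sign characters of the partial volume elements `η_S`) and `stub_absorption_cm`
  (some Hodge endomorphism not self-adjoint, `E` CM: degree projectors `p_k` / Skolem–Noether units);
* `TwistGeneration` (`M` is generated as a one-sided `𝔅`-module by the twisted embeddings) ⇐ the
  Mumford–Tate dictionary at the level of `ℚ`-points of the lifted Hodge group
  `G~(ℚ) = {g ∈ C even unit, g ι(T) g⁻¹ = ι(T), inducing γ ∈ Hdg(T)(ℚ)}` (tree `hodgeGroup`, instance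
  `hodgeTensorFacts_holds`): `stub_hodgeMaps_equivariant` (D1: `MT(KS~)` ⊇ the spin lift),
  `stub_commutant_preserves` (D2: the commutant of `G~(ℚ)` preserves `F¹_KS` — density + `J ∈ G~(ℝ)`),
  `stub_invariant_theory` (D3, the heart: Zarhin + slot count + descent);
* the glue `saturation_of_generation_of_absorption` (= the Theorems candidate
  `KugaSatakeSaturationSaturationSplit.lean`, kernel-checked): span induction, right-composition
  operator `Ψ_{b'} = compRight ℚ (lcomp ℚ C b')`, closure of `𝔅` under composition.

Gate shape: the five stub STATEMENTS are the local `def`s `AbsorptionReal`, `AbsorptionCM`,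
`HodgeMapsEquivariant`, `CommutantPreserves`, `InvariantTheory`; `sorry` occurs ONLY in the five
`stub_*` theorems; the implication content is sorry-free (`saturation_of_generation_of_absorption`,
`twistAbsorption_of`, `twistGeneration_of`, all concluding verbatim statements), and
`Saturation_of : Saturation` — the file's only theorem headed by the crux name — feeds them the stubs. Hardest stub: `stub_invariant_theory`. Disproof used: no `Disproof.lean` is registered for
this crux (none in the payload); the line honours the refuter analyses on the item (g41-24, rreview
0815: isotypic RM-odd case needs the anticommuting slot components — that is exactly
`stub_absorption_real`'s sign characters) and the crux idea `slot-parity-saturation` (evidence on 9371).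
-/

set_option linter.dupNamespace false

namespace Summit.HodgeConjecture.HodgeConjecture.Cruxes.Saturation.TwistSplit

open Literature.AlgebraicGeometry.Motives
open Summit.HodgeConjecture.HodgeConjecture.Theses.KugaSatakeSaturation

/-! ### The five stub statements -/

/-- A1 — real-multiplication case of `TwistAbsorption`: if every Hodge endomorphism of `T` is
`P`-self-adjoint (`E` totally real, Zarhin), every twisted embedding `κ ∘ e` lies in `N` (sign
characters of the partial volume elements `η_S ∈ Z_C(MT)`). [cite: VanGeemen2008RM, §5–6] [cite: Zarhin1983HodgeGroupsK3, Thm. 2.2.1] -/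
def AbsorptionReal : Prop :=
  ∀ (T : Type) [AddCommGroup T] [Module ℚ T] [Module.Finite ℚ T] (H : HodgeStructure T 2) (P : H.Polarization), H.F 3 = ⊥ → H.hodgeNumber 2 0 = 1 → (∀ t : T, HodgeStructure.ofRat t ∈ H.F 1 → t = 0) → (∀ a : H.Hom H, LinearMap.IsAdjointPair P.form P.form a.toLinearMap a.toLinearMap) → ∀ e : H.Hom H, (LinearMap.mul ℚ (CliffordAlgebra (LinearMap.BilinMap.toQuadraticMap P.form))).comp ((CliffordAlgebra.ι (LinearMap.BilinMap.toQuadraticMap P.form)).comp e.toLinearMap) ∈ Submodule.span ℚ {ν : T →ₗ[ℚ] Module.End ℚ (CliffordAlgebra (LinearMap.BilinMap.toQuadraticMap P.form)) | ∃ b b' : Module.End ℚ (CliffordAlgebra (LinearMap.BilinMap.toQuadraticMap P.form)), (Submodule.map ((CliffordAlgebra.ι (LinearMap.BilinMap.toQuadraticMap P.form)).baseChange ℂ) (H.piece 2 0) * ⊤).map (b.baseChange ℂ) ≤ (Submodule.map ((CliffordAlgebra.ι (LinearMap.BilinMap.toQuadraticMap P.form)).baseChange ℂ) (H.piece 2 0)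 * ⊤) ∧ (Submodule.map ((CliffordAlgebra.ι (LinearMap.BilinMap.toQuadraticMap P.form)).baseChange ℂ) (H.piece 2 0) * ⊤).map (b'.baseChange ℂ) ≤ (Submodule.map ((CliffordAlgebra.ι (LinearMap.BilinMap.toQuadraticMap P.form)).baseChange ℂ) (H.piece 2 0) * ⊤) ∧ ∀ t, ν t = b ∘ₗ LinearMap.mulLeft ℚ ((CliffordAlgebra.ι (LinearMap.BilinMap.toQuadraticMap P.form)) t) ∘ₗ b'}

/-- A2 — complex-multiplication case of `TwistAbsorption`: if some Hodge endomorphism of `T` is not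
`P`-self-adjoint (`E` a CM field, Zarhin), every twisted embedding `κ ∘ e` lies in `N` (degree
projectors `p_k` of the spinor module; Skolem–Noether units). [cite: vanGeemen2000KugaSatakeHC, §6] [cite: Zarhin1983HodgeGroupsK3, Thm. 2.3.1] -/
def AbsorptionCM : Prop :=
  ∀ (T : Type) [AddCommGroup T] [Module ℚ T] [Module.Finite ℚ T] (H : HodgeStructure T 2) (P : H.Polarization), H.F 3 = ⊥ → H.hodgeNumber 2 0 = 1 → (∀ t : T, HodgeStructure.ofRat t ∈ H.F 1 → t = 0) → (∃ a : H.Hom H, ¬ LinearMap.IsAdjointPair P.form P.form a.toLinearMap a.toLinearMap) → ∀ e : H.Hom H, (LinearMap.mul ℚ (CliffordAlgebra (LinearMap.BilinMap.toQuadraticMap P.form))).comp ((CliffordAlgebra.ι (LinearMap.BilinMap.toQuadraticMap P.form)).comp e.toLinearMap) ∈ Submodule.span ℚ {ν : T →ₗ[ℚ] Module.End ℚ (CliffordAlgebra (LinearMap.BilinMap.toQuadraticMap P.form)) | ∃ b b' : Module.End ℚ (CliffordAlgebra (LinearMap.BilinMap.toQuadraticMap P.form)), (Submodule.map ((CliffordAlgebra.ι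 (LinearMap.BilinMap.toQuadraticMap P.form)).baseChange ℂ) (H.piece 2 0) * ⊤).map (b.baseChange ℂ) ≤ (Submodule.map ((CliffordAlgebra.ι (LinearMap.BilinMap.toQuadraticMap P.form)).baseChange ℂ) (H.piece 2 0) * ⊤) ∧ (Submodule.map ((CliffordAlgebra.ι (LinearMap.BilinMap.toQuadraticMap P.form)).baseChange ℂ) (H.piece 2 0) * ⊤).map (b'.baseChange ℂ) ≤ (Submodule.map ((CliffordAlgebra.ι (LinearMap.BilinMap.toQuadraticMap P.form)).baseChange ℂ) (H.piece 2 0) * ⊤) ∧ ∀ t, ν t = b ∘ₗ LinearMap.mulLeft ℚ ((CliffordAlgebra.ι (LinearMap.BilinMap.toQuadraticMap P.form)) t) ∘ₗ b'}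

/-- D1 — Hodge maps `μ : T(1) → End(KS~)` are equivariant for the `ℚ`-points of the lifted Hodge group
(even units `g` of `C` normalising `ι(T)` and inducing `γ ∈ Hdg(T)(ℚ)`, tree `hodgeGroup`):
`μ(γ t) ∘ L_g = L_g ∘ μ(t)` — `MT(KS~)` is the full spin preimage of `Hdg(T)`.
[cite: vanGeemen2000KugaSatakeHC, Prop. 6.3] [cite: Huybrechts2016K3, Ch. 4 Prop. 2.6] -/
def HodgeMapsEquivariant : Prop :=
  ∀ (T : Type) [AddCommGroup T] [Module ℚ T] [Module.Finite ℚ T] [HodgeTensorFacts.{0, 0}] (H : HodgeStructure T 2) (P : H.Polarization), H.F 3 = ⊥ → H.hodgeNumber 2 0 = 1 → (∀ t : T, HodgeStructure.ofRat t ∈ H.F 1 → t = 0) → ∀ μ : T →ₗ[ℚ] Module.End ℚ (CliffordAlgebra (LinearMap.BilinMap.toQuadraticMap P.form)), (∀ w ∈ H.F 1, let g := HodgeStructure.homBaseChange _ _ (μ.baseChange ℂ w); (Submodule.map ((CliffordAlgebra.ι (LinearMap.BilinMap.toQuadraticMap P.form)).baseChange ℂ) (H.piece 2 0) * ⊤).map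 g ≤ (Submodule.map ((CliffordAlgebra.ι (LinearMap.BilinMap.toQuadraticMap P.form)).baseChange ℂ) (H.piece 2 0) * ⊤) ∧ (w ∈ H.piece 2 0 → LinearMap.range g ≤ (Submodule.map ((CliffordAlgebra.ι (LinearMap.BilinMap.toQuadraticMap P.form)).baseChange ℂ) (H.piece 2 0) * ⊤) ∧ (Submodule.map ((CliffordAlgebra.ι (LinearMap.BilinMap.toQuadraticMap P.form)).baseChange ℂ) (H.piece 2 0) * ⊤).map g = ⊥)) → (∀ (g : CliffordAlgebra (LinearMap.BilinMap.toQuadraticMap P.form)) (γ : T ≃ₗ[ℚ] T), IsUnit g → g ∈ CliffordAlgebra.evenOdd (LinearMap.BilinMap.toQuadraticMap P.form) 0 → (∀ t : T, g * CliffordAlgebra.ι (LinearMap.BilinMap.toQuadraticMap P.form) t = CliffordAlgebra.ι (LinearMap.BilinMap.toQuadraticMap P.form) (γ t) * g) → γ ∈ H.hodgeGroup → ∀ t : T, μ (γ t) ∘ₗ LinearMap.mulLeft ℚ g = LinearMap.mulLeft ℚ g ∘ₗ μ t)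

/-- D2 — the commutant of the `ℚ`-points of the lifted Hodge group preserves `F¹_KS` (Zariski density
of `G~(ℚ)` in the connected reductive `G~`; `J = f₁f₂ ∈ G~(ℝ)`, `F¹_KS = ker(L_J + i)`).
[cite: vanGeemen2000KugaSatakeHC, Lemma 5.5 and Prop. 5.7] -/
def CommutantPreserves : Prop :=
  ∀ (T : Type) [AddCommGroup T] [Module ℚ T] [Module.Finite ℚ T] [HodgeTensorFacts.{0, 0}] (H : HodgeStructure T 2) (P : H.Polarization), H.F 3 = ⊥ → H.hodgeNumber 2 0 = 1 → (∀ t : T, HodgeStructure.ofRat t ∈ H.F 1 → t = 0) → ∀ b : Module.End ℚ (CliffordAlgebra (LinearMap.BilinMap.toQuadraticMap P.form)), (∀ (g : CliffordAlgebra (LinearMap.BilinMap.toQuadraticMap P.form)) (γ : T ≃ₗ[ℚ] T), IsUnit g → g ∈ CliffordAlgebra.evenOdd (LinearMap.BilinMap.toQuadraticMap P.form) 0 → (∀ t : T, g * CliffordAlgebra.ι (LinearMap.BilinMap.toQuadraticMap P.form) t = CliffordAlgebra.ι (LinearMap.BilinMap.toQuadraticMap P.form) (γ t) * g) → γ ∈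 H.hodgeGroup → b ∘ₗ LinearMap.mulLeft ℚ g = LinearMap.mulLeft ℚ g ∘ₗ b) → (Submodule.map ((CliffordAlgebra.ι (LinearMap.BilinMap.toQuadraticMap P.form)).baseChange ℂ) (H.piece 2 0) * ⊤).map (b.baseChange ℂ) ≤ (Submodule.map ((CliffordAlgebra.ι (LinearMap.BilinMap.toQuadraticMap P.form)).baseChange ℂ) (H.piece 2 0) * ⊤)

/-- D3 — INVARIANT THEORY (the heart): a `G~(ℚ)`-equivariant `μ : T → End C` lies in the span of the
one-sided generators `L_{ι(e t)} ∘ b'`, `e ∈ End_Hdg(T)`, `b'` in the commutant of `G~(ℚ)` (Zarhin's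
Hodge group, density, slot count over `ℚ̄` — RM: `η_S`; CM: `p_k` —, Galois descent).
[cite: Zarhin1983HodgeGroupsK3, Thm. 2.2.1 and 2.3.1] [cite: VanGeemen2008RM, §5–6] -/
def InvariantTheory : Prop :=
  ∀ (T : Type) [AddCommGroup T] [Module ℚ T] [Module.Finite ℚ T] [HodgeTensorFacts.{0, 0}] (H : HodgeStructure T 2) (P : H.Polarization), H.F 3 = ⊥ → H.hodgeNumber 2 0 = 1 → (∀ t : T, HodgeStructure.ofRat t ∈ H.F 1 → t = 0) → ∀ μ : T →ₗ[ℚ] Module.End ℚ (CliffordAlgebra (LinearMap.BilinMap.toQuadraticMap P.form)), (∀ (g : CliffordAlgebra (LinearMap.BilinMap.toQuadraticMap P.form)) (γ : T ≃ₗ[ℚ] T), IsUnit g → g ∈ CliffordAlgebra.evenOdd (LinearMap.BilinMap.toQuadraticMap P.form) 0 → (∀ t : T, g * CliffordAlgebra.ι (LinearMap.BilinMap.toQuadraticMap P.form) t = CliffordAlgebra.ι (LinearMap.BilinMap.toQuadraticMap P.form) (γ t) * g) → γ ∈ H.hodgeGroup → ∀ t : T, μ (γ t) ∘ₗ LinearMap.mulLeft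 ℚ g = LinearMap.mulLeft ℚ g ∘ₗ μ t) → μ ∈ Submodule.span ℚ {ν : T →ₗ[ℚ] Module.End ℚ (CliffordAlgebra (LinearMap.BilinMap.toQuadraticMap P.form)) | ∃ (e : H.Hom H) (b' : Module.End ℚ (CliffordAlgebra (LinearMap.BilinMap.toQuadraticMap P.form))), (∀ (g : CliffordAlgebra (LinearMap.BilinMap.toQuadraticMap P.form)) (γ : T ≃ₗ[ℚ] T), IsUnit g → g ∈ CliffordAlgebra.evenOdd (LinearMap.BilinMap.toQuadraticMap P.form) 0 → (∀ t : T, g * CliffordAlgebra.ι (LinearMap.BilinMap.toQuadraticMap P.form) t = CliffordAlgebra.ι (LinearMap.BilinMap.toQuadraticMap P.form) (γ t) * g) → γ ∈ H.hodgeGroup → b' ∘ₗ LinearMap.mulLeft ℚ g = LinearMap.mulLeft ℚ g ∘ₗ b') ∧ ∀ t, ν t = LinearMap.mulLeft ℚ ((CliffordAlgebra.ι (LinearMap.BilinMap.toQuadraticMap P.form)) (e.toLinearMap t)) ∘ₗ b'}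

/-! ### The stubs (the only `sorry`s of the file) -/

/-- STUB A1 (size L). [cite: VanGeemen2008RM, §5–6] -/
theorem stub_absorption_real : AbsorptionReal := by
  sorry

/-- STUB A2 (size L). [cite: vanGeemen2000KugaSatakeHC, §6] -/
theorem stub_absorption_cm : AbsorptionCM := by
  sorry

/-- STUB D1 (size M/L). [cite: vanGeemen2000KugaSatakeHC, Prop. 6.3] -/
theorem stub_hodgeMaps_equivariant : HodgeMapsEquivariant := by
  sorry

/-- STUB D2 (size M). [cite: vanGeemen2000KugaSatakeHC, Lemma 5.5 and Prop. 5.7] -/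
theorem stub_commutant_preserves : CommutantPreserves := by
  sorry

/-- STUB D3 (size L, hardest). [cite: Zarhin1983HodgeGroupsK3, Thm. 2.2.1 and 2.3.1] -/
theorem stub_invariant_theory : InvariantTheory := by
  sorry

/-! ### Sorry-free compositions (all conclude verbatim statements) -/

/-- The glue: `TwistGeneration → TwistAbsorption → Saturation`, all three spelled out verbatim
(identical proof to the Theorems candidate `saturation_of_twistGeneration_of_twistAbsorption`): span
induction, right-composition operator `Ψ_{b'} = compRight ℚ (lcomp ℚ C b')`, closure of `𝔅` under
composition. [cite: vanGeemen2000KugaSatakeHC, Prop. 6.3 and Lemma 6.5] -/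
theorem saturation_of_generation_of_absorption :
    (∀ (T : Type) [AddCommGroup T] [Module ℚ T] [Module.Finite ℚ T] (H : HodgeStructure T 2) (P : H.Polarization), H.F 3 = ⊥ → H.hodgeNumber 2 0 = 1 → (∀ t : T, HodgeStructure.ofRat t ∈ H.F 1 → t = 0) → ∀ μ : T →ₗ[ℚ] Module.End ℚ (CliffordAlgebra (LinearMap.BilinMap.toQuadraticMap P.form)), (∀ w ∈ H.F 1, let g := HodgeStructure.homBaseChange _ _ (μ.baseChange ℂ w); (Submodule.map ((CliffordAlgebra.ι (LinearMap.BilinMap.toQuadraticMap P.form)).baseChange ℂ) (H.piece 2 0) * ⊤).map g ≤ (Submodule.map ((CliffordAlgebra.ι (LinearMap.BilinMap.toQuadraticMap P.form)).baseChange ℂ) (H.piece 2 0) * ⊤) ∧ (w ∈ H.piece 2 0 → LinearMap.range g ≤ (Submodule.map ((CliffordAlgebra.ι (LinearMap.BilinMap.toQuadraticMap P.form)).baseChange ℂ) (H.piece 2 0) * ⊤) ∧ (Submodule.map ((CliffordAlgebra.ι (LinearMap.BilinMap.toQuadraticMap P.form)).baseChange ℂ) (H.piece 2 0) * ⊤).map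 g = ⊥)) → μ ∈ Submodule.span ℚ {ν : T →ₗ[ℚ] Module.End ℚ (CliffordAlgebra (LinearMap.BilinMap.toQuadraticMap P.form)) | ∃ (e : H.Hom H) (b' : Module.End ℚ (CliffordAlgebra (LinearMap.BilinMap.toQuadraticMap P.form))), (Submodule.map ((CliffordAlgebra.ι (LinearMap.BilinMap.toQuadraticMap P.form)).baseChange ℂ) (H.piece 2 0) * ⊤).map (b'.baseChange ℂ) ≤ (Submodule.map ((CliffordAlgebra.ι (LinearMap.BilinMap.toQuadraticMap P.form)).baseChange ℂ) (H.piece 2 0) * ⊤) ∧ ∀ t, ν t = LinearMap.mulLeft ℚ ((CliffordAlgebra.ι (LinearMap.BilinMap.toQuadraticMap P.form)) (e.toLinearMap t)) ∘ₗ b'}) →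
    (∀ (T : Type) [AddCommGroup T] [Module ℚ T] [Module.Finite ℚ T] (H : HodgeStructure T 2) (P : H.Polarization), H.F 3 = ⊥ → H.hodgeNumber 2 0 = 1 → (∀ t : T, HodgeStructure.ofRat t ∈ H.F 1 → t = 0) → ∀ e : H.Hom H, (LinearMap.mul ℚ (CliffordAlgebra (LinearMap.BilinMap.toQuadraticMap P.form))).comp ((CliffordAlgebra.ι (LinearMap.BilinMap.toQuadraticMap P.form)).comp e.toLinearMap) ∈ Submodule.span ℚ {ν : T →ₗ[ℚ] Module.End ℚ (CliffordAlgebra (LinearMap.BilinMap.toQuadraticMap P.form)) | ∃ b b' : Module.End ℚ (CliffordAlgebra (LinearMap.BilinMap.toQuadraticMap P.form)), (Submodule.map ((CliffordAlgebra.ι (LinearMap.BilinMap.toQuadraticMap P.form)).baseChange ℂ) (H.piece 2 0) * ⊤).map (b.baseChange ℂ) ≤ (Submodule.map ((CliffordAlgebra.ι (LinearMap.BilinMap.toQuadraticMap P.form)).baseChange ℂ) (H.piece 2 0) * ⊤) ∧ (Submodule.map ((CliffordAlgebra.ι (LinearMap.BilinMap.toQuadraticMap P.form)).baseChange ℂ)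 (H.piece 2 0) * ⊤).map (b'.baseChange ℂ) ≤ (Submodule.map ((CliffordAlgebra.ι (LinearMap.BilinMap.toQuadraticMap P.form)).baseChange ℂ) (H.piece 2 0) * ⊤) ∧ ∀ t, ν t = b ∘ₗ LinearMap.mulLeft ℚ ((CliffordAlgebra.ι (LinearMap.BilinMap.toQuadraticMap P.form)) t) ∘ₗ b'}) →
    (∀ (T : Type) [AddCommGroup T] [Module ℚ T] [Module.Finite ℚ T] (H : HodgeStructure T 2) (P : H.Polarization), H.F 3 = ⊥ → H.hodgeNumber 2 0 = 1 → (∀ t : T, HodgeStructure.ofRat t ∈ H.F 1 → t = 0) → ∀ μ : T →ₗ[ℚ] Module.End ℚ (CliffordAlgebra (LinearMap.BilinMap.toQuadraticMap P.form)), (∀ w ∈ H.F 1, let g := HodgeStructure.homBaseChange _ _ (μ.baseChange ℂ w); (Submodule.map ((CliffordAlgebra.ι (LinearMap.BilinMap.toQuadraticMap P.form)).baseChange ℂ) (H.piece 2 0) * ⊤).map g ≤ (Submodule.map ((CliffordAlgebra.ι (LinearMap.BilinMap.toQuadraticMap P.form)).baseChange ℂ) (H.piece 2 0) * ⊤) ∧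 (w ∈ H.piece 2 0 → LinearMap.range g ≤ (Submodule.map ((CliffordAlgebra.ι (LinearMap.BilinMap.toQuadraticMap P.form)).baseChange ℂ) (H.piece 2 0) * ⊤) ∧ (Submodule.map ((CliffordAlgebra.ι (LinearMap.BilinMap.toQuadraticMap P.form)).baseChange ℂ) (H.piece 2 0) * ⊤).map g = ⊥)) → μ ∈ Submodule.span ℚ {ν : T →ₗ[ℚ] Module.End ℚ (CliffordAlgebra (LinearMap.BilinMap.toQuadraticMap P.form)) | ∃ b b' : Module.End ℚ (CliffordAlgebra (LinearMap.BilinMap.toQuadraticMap P.form)), (Submodule.map ((CliffordAlgebra.ι (LinearMap.BilinMap.toQuadraticMap P.form)).baseChange ℂ) (H.piece 2 0) * ⊤).map (b.baseChange ℂ) ≤ (Submodule.map ((CliffordAlgebra.ι (LinearMap.BilinMap.toQuadraticMap P.form)).baseChange ℂ) (H.piece 2 0) * ⊤) ∧ (Submodule.map ((CliffordAlgebra.ι (LinearMap.BilinMap.toQuadraticMap P.form)).baseChange ℂ) (H.piece 2 0) * ⊤).map (b'.baseChange ℂ) ≤ (Submodule.map ((CliffordAlgebra.ι (LinearMap.BilinMap.toQuadraticMap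 P.form)).baseChange ℂ) (H.piece 2 0) * ⊤) ∧ ∀ t, ν t = b ∘ₗ LinearMap.mulLeft ℚ ((CliffordAlgebra.ι (LinearMap.BilinMap.toQuadraticMap P.form)) t) ∘ₗ b'}) := by
  intro hGen hAbs T _ _ _ H P hF3 h20 hirr μ hμ
  have h₁ := hGen T H P hF3 h20 hirr μ hμ
  refine (Submodule.span_le.mpr ?_) h₁
  rintro ν ⟨e, b', hb', hν⟩
  -- the twisted embedding `κ ∘ e` lies in `N`
  have h₂ := hAbs T H P hF3 h20 hirr e
  -- the right-composition operator `Ψ ν := (t ↦ ν t ∘ b')`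
  let Ψ : (T →ₗ[ℚ] Module.End ℚ (CliffordAlgebra (LinearMap.BilinMap.toQuadraticMap P.form))) →ₗ[ℚ]
      (T →ₗ[ℚ] Module.End ℚ (CliffordAlgebra (LinearMap.BilinMap.toQuadraticMap P.form))) :=
    LinearMap.compRight ℚ (LinearMap.lcomp ℚ _ b')
  have hνΨ : ν = Ψ ((LinearMap.mul ℚ (CliffordAlgebra (LinearMap.BilinMap.toQuadraticMap P.form))).comp
      ((CliffordAlgebra.ι (LinearMap.BilinMap.toQuadraticMap P.form)).comp e.toLinearMap)) := by
    apply LinearMap.ext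
    intro t
    rw [hν t]
    apply LinearMap.ext
    intro x
    simp [Ψ]
  -- `N` is `Ψ`-stable: `𝔅` is closed under composition
  have hstable : Submodule.map Ψ (Submodule.span ℚ {ν : T →ₗ[ℚ] Module.End ℚ (CliffordAlgebra (LinearMap.BilinMap.toQuadraticMap P.form)) | ∃ b b' : Module.End ℚ (CliffordAlgebra (LinearMap.BilinMap.toQuadraticMap P.form)), (Submodule.map ((CliffordAlgebra.ι (LinearMap.BilinMap.toQuadraticMap P.form)).baseChange ℂ) (H.piece 2 0) * ⊤).map (b.baseChange ℂ) ≤ (Submodule.map ((CliffordAlgebra.ι (LinearMap.BilinMap.toQuadraticMap P.form)).baseChange ℂ) (H.piece 2 0) * ⊤) ∧ (Submodule.map ((CliffordAlgebra.ι (LinearMap.BilinMap.toQuadraticMap P.form)).baseChange ℂ) (H.piece 2 0) * ⊤).map (b'.baseChange ℂ) ≤ (Submodule.map ((CliffordAlgebra.ι (LinearMap.BilinMap.toQuadraticMap P.form)).baseChange ℂ) (H.piece 2 0) * ⊤) ∧ ∀ t, ν t = b ∘ₗ LinearMap.mulLeft ℚ ((CliffordAlgebra.ι (LinearMap.BilinMap.toQuadraticMap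 P.form)) t) ∘ₗ b'}) ≤
      Submodule.span ℚ {ν : T →ₗ[ℚ] Module.End ℚ (CliffordAlgebra (LinearMap.BilinMap.toQuadraticMap P.form)) | ∃ b b' : Module.End ℚ (CliffordAlgebra (LinearMap.BilinMap.toQuadraticMap P.form)), (Submodule.map ((CliffordAlgebra.ι (LinearMap.BilinMap.toQuadraticMap P.form)).baseChange ℂ) (H.piece 2 0) * ⊤).map (b.baseChange ℂ) ≤ (Submodule.map ((CliffordAlgebra.ι (LinearMap.BilinMap.toQuadraticMap P.form)).baseChange ℂ) (H.piece 2 0) * ⊤) ∧ (Submodule.map ((CliffordAlgebra.ι (LinearMap.BilinMap.toQuadraticMap P.form)).baseChange ℂ) (H.piece 2 0) * ⊤).map (b'.baseChange ℂ) ≤ (Submodule.map ((CliffordAlgebra.ι (LinearMap.BilinMap.toQuadraticMap P.form)).baseChange ℂ) (H.piece 2 0) * ⊤) ∧ ∀ t, ν t = b ∘ₗ LinearMap.mulLeft ℚ ((CliffordAlgebra.ι (LinearMap.BilinMap.toQuadraticMap P.form)) t) ∘ₗ b'} := by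
    rw [Submodule.map_span, Submodule.span_le]
    rintro _ ⟨ν', ⟨b, b'', hb, hb'', hν'⟩, rfl⟩
    refine Submodule.subset_span ⟨b, b'' ∘ₗ b', hb, ?_, ?_⟩
    · rw [LinearMap.baseChange_comp, Submodule.map_comp]
      exact (Submodule.map_mono hb').trans hb''
    · intro t
      apply LinearMap.ext
      intro x
      simp [Ψ, hν' t]
  rw [hνΨ]
  exact hstable (Submodule.mem_map_of_mem h₂)

/-- `TwistAbsorption` (verbatim) from the Zarhin dichotomy A1/A2 (excluded middle on "every Hodge
endomorphism is `P`-self-adjoint"). [cite: Zarhin1983HodgeGroupsK3, Thm. 1.5.1] -/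
theorem twistAbsorption_of (h₁ : AbsorptionReal) (h₂ : AbsorptionCM) :
    ∀ (T : Type) [AddCommGroup T] [Module ℚ T] [Module.Finite ℚ T] (H : HodgeStructure T 2) (P : H.Polarization), H.F 3 = ⊥ → H.hodgeNumber 2 0 = 1 → (∀ t : T, HodgeStructure.ofRat t ∈ H.F 1 → t = 0) → ∀ e : H.Hom H, (LinearMap.mul ℚ (CliffordAlgebra (LinearMap.BilinMap.toQuadraticMap P.form))).comp ((CliffordAlgebra.ι (LinearMap.BilinMap.toQuadraticMap P.form)).comp e.toLinearMap) ∈ Submodule.span ℚ {ν : T →ₗ[ℚ] Module.End ℚ (CliffordAlgebra (LinearMap.BilinMap.toQuadraticMap P.form)) | ∃ b b' : Module.End ℚ (CliffordAlgebra (LinearMap.BilinMap.toQuadraticMap P.form)), (Submodule.map ((CliffordAlgebra.ι (LinearMap.BilinMap.toQuadraticMap P.form)).baseChange ℂ) (H.piece 2 0) * ⊤).map (b.baseChange ℂ) ≤ (Submodule.map ((CliffordAlgebra.ι (LinearMap.BilinMap.toQuadraticMap P.form)).baseChange ℂ) (H.piece 2 0) * ⊤) ∧ (Submodule.map ((CliffordAlgebra.ι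 (LinearMap.BilinMap.toQuadraticMap P.form)).baseChange ℂ) (H.piece 2 0) * ⊤).map (b'.baseChange ℂ) ≤ (Submodule.map ((CliffordAlgebra.ι (LinearMap.BilinMap.toQuadraticMap P.form)).baseChange ℂ) (H.piece 2 0) * ⊤) ∧ ∀ t, ν t = b ∘ₗ LinearMap.mulLeft ℚ ((CliffordAlgebra.ι (LinearMap.BilinMap.toQuadraticMap P.form)) t) ∘ₗ b'} := by
  intro T _ _ _ H P hF3 h20 hirr e
  by_cases hadj : ∀ a : H.Hom H, LinearMap.IsAdjointPair P.form P.form a.toLinearMap a.toLinearMap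
  · exact h₁ T H P hF3 h20 hirr hadj e
  · push Not at hadj
    exact h₂ T H P hF3 h20 hirr hadj e

/-- `TwistGeneration` (verbatim) from the MT dictionary D1/D2/D3: D1 gives the equivariance of `μ`,
D3 puts `μ` in the span of the `L_{ι(e ·)} ∘ b'` with `b'` in the commutant, D2 enlarges the
commutant condition to `b' ∈ 𝔅` generator by generator (`Submodule.span_mono`); the tensor facts
instance is the tree theorem `hodgeTensorFacts_holds`. [cite: vanGeemen2000KugaSatakeHC, §6] -/
theorem twistGeneration_of (h₁ : HodgeMapsEquivariant) (h₂ : CommutantPreserves)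
    (h₃ : InvariantTheory) :
    ∀ (T : Type) [AddCommGroup T] [Module ℚ T] [Module.Finite ℚ T] (H : HodgeStructure T 2) (P : H.Polarization), H.F 3 = ⊥ → H.hodgeNumber 2 0 = 1 → (∀ t : T, HodgeStructure.ofRat t ∈ H.F 1 → t = 0) → ∀ μ : T →ₗ[ℚ] Module.End ℚ (CliffordAlgebra (LinearMap.BilinMap.toQuadraticMap P.form)), (∀ w ∈ H.F 1, let g := HodgeStructure.homBaseChange _ _ (μ.baseChange ℂ w); (Submodule.map ((CliffordAlgebra.ι (LinearMap.BilinMap.toQuadraticMap P.form)).baseChange ℂ) (H.piece 2 0) * ⊤).map g ≤ (Submodule.map ((CliffordAlgebra.ι (LinearMap.BilinMap.toQuadraticMap P.form)).baseChange ℂ) (H.piece 2 0) * ⊤) ∧ (w ∈ H.piece 2 0 → LinearMap.range g ≤ (Submodule.map ((CliffordAlgebra.ι (LinearMap.BilinMap.toQuadraticMap P.form)).baseChange ℂ) (H.piece 2 0) * ⊤) ∧ (Submodule.map ((CliffordAlgebra.ι (LinearMap.BilinMap.toQuadraticMap P.form)).baseChange ℂ) (H.piece 2 0) * ⊤).map g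 = ⊥)) → μ ∈ Submodule.span ℚ {ν : T →ₗ[ℚ] Module.End ℚ (CliffordAlgebra (LinearMap.BilinMap.toQuadraticMap P.form)) | ∃ (e : H.Hom H) (b' : Module.End ℚ (CliffordAlgebra (LinearMap.BilinMap.toQuadraticMap P.form))), (Submodule.map ((CliffordAlgebra.ι (LinearMap.BilinMap.toQuadraticMap P.form)).baseChange ℂ) (H.piece 2 0) * ⊤).map (b'.baseChange ℂ) ≤ (Submodule.map ((CliffordAlgebra.ι (LinearMap.BilinMap.toQuadraticMap P.form)).baseChange ℂ) (H.piece 2 0) * ⊤) ∧ ∀ t, ν t = LinearMap.mulLeft ℚ ((CliffordAlgebra.ι (LinearMap.BilinMap.toQuadraticMap P.form)) (e.toLinearMap t)) ∘ₗ b'} := by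
  intro T _ _ _ H P hF3 h20 hirr μ hμ
  haveI : HodgeTensorFacts.{0, 0} := hodgeTensorFacts_holds
  have hequiv := h₁ T H P hF3 h20 hirr μ hμ
  have hspan := h₃ T H P hF3 h20 hirr μ hequiv
  refine Submodule.span_mono ?_ hspan
  rintro ν ⟨e, b', hb', hν⟩
  exact ⟨e, b', h₂ T H P hF3 h20 hirr b' hb', hν⟩

/-! ### The skeleton theorem -/

/-- **THE SKELETON THEOREM.** The crux
`Summit.HodgeConjecture.HodgeConjecture.Theses.KugaSatakeSaturation.Saturation`, concluded BY NAME from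
the five DECLARED stubs (the only `sorry`s of the file) through the sorry-free compositions.
[cite: vanGeemen2000KugaSatakeHC, Prop. 6.3] [cite: Zarhin1983HodgeGroupsK3, Thm. 2.2.1 and 2.3.1] -/
theorem Saturation_of : Saturation :=
  saturation_of_generation_of_absorption
    (twistGeneration_of stub_hodgeMaps_equivariant stub_commutant_preserves stub_invariant_theory)
    (twistAbsorption_of stub_absorption_real stub_absorption_cm)

end Summit.HodgeConjecture.HodgeConjecture.Cruxes.Saturation.TwistSplit
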